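import Mathlib
import HarnessLib
import Summits.HubbardSuperconductivity.HubbardSuperconductivity.Theorems.KLProgrammeKLRegimeEngineV8DefsU6
import Summits.HubbardSuperconductivity.HubbardSuperconductivity.Theorems.KLProgrammeKLRegimeSplitTwoLegThresholdsExplicit

/-!
# K3 ENGINE package v7 — the (E3-THR) threshold door of the engine-flow child's two-leg slot:
# `klE3A1 R` (the bare-frame weighted decay constant, `|U| ≤ 1` majorant), `klE3U₀ R`, `klEngU₀7 P R c := min (klEngU₀6 P R c) (klE3U₀ R)`

Cell `gate-hubbard-kl`, seat p1b (g8), (M) owner; finding (E3-THR), KL STATUS 2026-08-27 ≈13:05Z (same class as p4 g9's (E4-THR) → (R29) `…DefsU6`).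
The two-leg slot's (E3d)/(E3e) conjunct `TwoLegSlopes … K_n n` asks `|z_n − 1| ≤ R.cz·|U|` and a normal slope `≤ R.cz·|U|·|e_K|`; at the bare frame
both start at SECOND order with an `R`-independent coefficient, so the coupling threshold must shrink with `R.cz` («every `cz > 0` is met for
`U ≤ U₀(R)`», the slot's design sentence) — `klEngU₀6` does not (it carries no `cz`).  This file adds the door:
* §1 **`klE3A1 R`** — the `|U| ≤ 1`, `Nsc = 0` majorant of p3 g8's definite `gridLabelWt`-weighted decay constant of the BARE scale-`0` grid covariance
  (`rowSum_scaleZero_gridLabelWt_le_X5` at `K = 0`): `klScaleZeroA0 + uvTimeMomentConst klE0 7 32 + 2·(X₀ + Y·(4608·(1+Gfr₀+Gfr₁+Gfr₂+Gfr₃)⁴·3))`;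
  `klScaleZeroA0_le_klE3A1`, `klE3A1_pos`, **`bareAlphaOne_le_klE3A1`** (the `a₁`-hypothesis `hA` of p1b's `twoLegSlopes_bareFrame` /
  `twoLegStepV17F2_zero_klC4a` at `a₁ := klE3A1 R`, for `|U| ≤ 1`);
* §2 **`klE3U₀ R := min (1/(64·e⁹·κ₀²·klE3A1 R)) (R.cz·(23/200)/(2^{11}·e¹⁸·κ₀⁴·klE3A1 R + (4/3)·|R.Gfr 1| + 1))`** (`κ₀² = 2(7+1606732)`),
  `klE3U₀_pos (h : 0 < R.cz)`; **`klEngU₀7 P R c := min (klEngU₀6 P R c) (klE3U₀ R)`**, `klEngU₀7_pos` (under `0 < R.cz`, i.e. `R.WF2`),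
  `klEngU₀7_le_klEngU₀6 / _le_klE3U₀ / _le_klEngU₀4 / _le_klEngU₀3` (every closer keyed on an older threshold survives by one `le_trans`);
* §3 **`bareFrame_numerals_of_le_klE3U₀`** — under `0 < R.cz`, `0 < U ≤ klE3U₀ R`: the four scale-`0` numerals of the (M) closers with `a₁ := klE3A1 R`
  (`16e⁹κ₀²·klScaleZeroA0·|U| ≤ 1/4`, `16e⁹κ₀²·a₁·|U| ≤ 1/2`, `2^{10}e¹⁸κ₀⁴a₁U² ≤ cz|U|`, `2^{11}e¹⁸κ₀⁴a₁U² + (4/3)Gfr₁U² ≤ cz|U|·cDtmin(−1.2)(−0.05)/2`,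
  the last by [tree] `cDtmin_wide_ge : 23/100 ≤ cDtmin (−1.2) (−0.05)`).
Definitions (closed real terms) + their signs + one arithmetic discharge; nothing about the model is asserted; nothing asserts superconductivity.
Risk-register item 1 disclosure: `klE3U₀` is closed but non-numeric (it reads `uvTimeMomentConst`, `uvSpaceMomentConst`, `klCutoffX5`).
-/

noncomputable section

namespace Summit.HubbardSuperconductivity.HubbardSuperconductivity.Theorems.EngineV8

set_option linter.dupNamespace false -- summit = problem name (single-conjunct summit), D-0017

open Real Finset Literature.MathematicalPhysics.QuantumLattice Literature.Probability.LatticeModels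
open Literature.MathematicalPhysics.QuantumLattice.BandSectorCounting
open Summit.HubbardSuperconductivity.HubbardSuperconductivity.Theorems.KLRegimeSplit

/-! ## §1 The bare-frame weighted decay constant, `|U| ≤ 1` majorant -/

/-- **`klE3A1 R`** — the `|U| ≤ 1` majorant (frame depth `Nsc = 0`) of p3 g8's definite `gridLabelWt`-weighted decay constant of the bare scale-`0`
grid covariance: `klScaleZeroA0 + uvTimeMomentConst klE0 7 32 + 2·(X₀ + Y·(4608·(1+Gfr₀+Gfr₁+Gfr₂+Gfr₃)⁴·3))`. -/
def klE3A1 (R : RenConsts) : ℝ :=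
  klScaleZeroA0 + uvTimeMomentConst klE0 7 32 +
    2 * (uvSpaceMomentConst klE0 1 (uvPieceSq klE0 (uvBaseQ klCutoffX5 klE0 4) (uvBaseQ' klCutoffX5 klE0 4)) +
      (1 / 4 * Real.sqrt (216 * (1 / klE0 + 1 / 2)) *
          ∑ e : Fin 2 × Fin 2, (uvLinV klE0 (1 + (e.1 : ℕ) + (e.2 : ℕ)) *
              (klCutoffX5 * ((1 + ((e.1 : ℕ) + (e.2 : ℕ)) + 2).factorial : ℝ) * (4 / klE0) ^ (1 + ((e.1 : ℕ) + (e.2 : ℕ)) + 1)) +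
            uvLinD klE0 (1 + (e.1 : ℕ) + (e.2 : ℕ)) *
              (klCutoffX5 * ((1 + ((e.1 : ℕ) + (e.2 : ℕ)) + 3).factorial : ℝ) * (4 / klE0) ^ (1 + ((e.1 : ℕ) + (e.2 : ℕ)) + 2)))) *
        (4608 * (1 + R.Gfr 0 + R.Gfr 1 + R.Gfr 2 + R.Gfr 3) ^ 4 * 3))

/-- `0 ≤ uvTimeMomentConst klE0 7 32` (a product of square roots). -/
theorem uvTimeMomentConst_klE0_nonneg : 0 ≤ uvTimeMomentConst klE0 7 32 := by
  unfold uvTimeMomentConst; positivity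

/-- The frame-slope factor `Y` of `klE3A1` is nonnegative. -/
theorem klE3Y_nonneg :
    0 ≤ 1 / 4 * Real.sqrt (216 * (1 / klE0 + 1 / 2)) *
          ∑ e : Fin 2 × Fin 2, (uvLinV klE0 (1 + (e.1 : ℕ) + (e.2 : ℕ)) *
              (klCutoffX5 * ((1 + ((e.1 : ℕ) + (e.2 : ℕ)) + 2).factorial : ℝ) * (4 / klE0) ^ (1 + ((e.1 : ℕ) + (e.2 : ℕ)) + 1)) +
            uvLinD klE0 (1 + (e.1 : ℕ) + (e.2 : ℕ)) *
              (klCutoffX5 * ((1 + ((e.1 : ℕ) + (e.2 : ℕ)) + 3).factorial : ℝ) * (4 / klE0) ^ (1 + ((e.1 : ℕ) + (e.2 : ℕ)) + 2))) := by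
  have hE : (0 : ℝ) < klE0 := by norm_num [klE0]
  have hX : 0 ≤ klCutoffX5 := zero_le_one.trans one_le_klCutoffX5
  refine mul_nonneg (by positivity) (Finset.sum_nonneg fun e _ => add_nonneg ?_ ?_)
  · exact mul_nonneg (uvLinV_nonneg hE _) (by positivity)
  · exact mul_nonneg (uvLinD_nonneg hE _) (by positivity)

/-- `klScaleZeroA0 ≤ klE3A1 R` for every `R`. -/
theorem klScaleZeroA0_le_klE3A1 (R : RenConsts) : klScaleZeroA0 ≤ klE3A1 R := by
  unfold klE3A1
  have h1 := uvTimeMomentConst_klE0_nonneg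
  have h2 := uvSpaceMomentConst_nonneg klE0 1 (uvPieceSq klE0 (uvBaseQ klCutoffX5 klE0 4) (uvBaseQ' klCutoffX5 klE0 4))
  have h3 := klE3Y_nonneg
  have h4 : 0 ≤ 4608 * (1 + R.Gfr 0 + R.Gfr 1 + R.Gfr 2 + R.Gfr 3) ^ 4 * 3 := by positivity
  nlinarith [mul_nonneg h3 h4]

/-- `0 < klE3A1 R` for every `R`. -/
theorem klE3A1_pos (R : RenConsts) : 0 < klE3A1 R := lt_of_lt_of_le klScaleZeroA0_pos (klScaleZeroA0_le_klE3A1 R)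

/-- **The `a₁`-hypothesis of the bare-frame two-leg closers at `a₁ := klE3A1 R`**: for `|U| ≤ 1`, p3's constant (depth `Nsc = 0`) is `≤ klE3A1 R`. -/
theorem bareAlphaOne_le_klE3A1 (R : RenConsts) {U : ℝ} (hU1 : |U| ≤ 1) :
    klScaleZeroA0 + uvTimeMomentConst klE0 7 32 +
          2 * (uvSpaceMomentConst klE0 1 (uvPieceSq klE0 (uvBaseQ klCutoffX5 klE0 4) (uvBaseQ' klCutoffX5 klE0 4)) +
            (1 / 4 * Real.sqrt (216 * (1 / klE0 + 1 / 2)) *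
                ∑ e : Fin 2 × Fin 2, (uvLinV klE0 (1 + (e.1 : ℕ) + (e.2 : ℕ)) *
                    (klCutoffX5 * ((1 + ((e.1 : ℕ) + (e.2 : ℕ)) + 2).factorial : ℝ) * (4 / klE0) ^ (1 + ((e.1 : ℕ) + (e.2 : ℕ)) + 1)) +
                  uvLinD klE0 (1 + (e.1 : ℕ) + (e.2 : ℕ)) *
                    (klCutoffX5 * ((1 + ((e.1 : ℕ) + (e.2 : ℕ)) + 3).factorial : ℝ) * (4 / klE0) ^ (1 + ((e.1 : ℕ) + (e.2 : ℕ)) + 2)))) *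
              (4608 * (1 + R.Gfr 0 + R.Gfr 1 + R.Gfr 2 + R.Gfr 3) ^ 4 * ((((0 : ℕ) : ℝ) + 1) * U ^ 2 + 2 * |U|))) ≤ klE3A1 R := by
  have h3 := klE3Y_nonneg
  have hU2 : U ^ 2 ≤ 1 := by rw [← sq_abs]; nlinarith [abs_nonneg U]
  have hfac : (((0 : ℕ) : ℝ) + 1) * U ^ 2 + 2 * |U| ≤ 3 := by push_cast; nlinarith [abs_nonneg U]
  have hG : 0 ≤ 4608 * (1 + R.Gfr 0 + R.Gfr 1 + R.Gfr 2 + R.Gfr 3) ^ 4 := by positivity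
  have hkey : 4608 * (1 + R.Gfr 0 + R.Gfr 1 + R.Gfr 2 + R.Gfr 3) ^ 4 * ((((0 : ℕ) : ℝ) + 1) * U ^ 2 + 2 * |U|) ≤
      4608 * (1 + R.Gfr 0 + R.Gfr 1 + R.Gfr 2 + R.Gfr 3) ^ 4 * 3 := mul_le_mul_of_nonneg_left hfac hG
  have hmono := mul_le_mul_of_nonneg_left hkey h3
  unfold klE3A1
  linarith [hmono]

/-! ## §2 The (E3-THR) doors -/

/-- **`klE3U₀ R`** — the two-leg (E3d)/(E3e) coupling door: `min (1/(64e⁹κ₀²·klE3A1 R)) (R.cz·(23/200)/(2^{11}e¹⁸κ₀⁴·klE3A1 R + (4/3)|Gfr₁| + 1))`. -/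
def klE3U₀ (R : RenConsts) : ℝ :=
  min (1 / (64 * Real.exp 1 ^ 9 * Real.sqrt (2 * (7 + 1606732)) ^ 2 * klE3A1 R))
    (R.cz * (23 / 200) / ((2 : ℝ) ^ 11 * Real.exp 1 ^ 18 * Real.sqrt (2 * (7 + 1606732)) ^ 4 * klE3A1 R + 4 / 3 * |R.Gfr 1| + 1))

/-- `0 < klE3U₀ R` whenever `0 < R.cz` (in particular under `R.WF2`). -/
theorem klE3U₀_pos {R : RenConsts} (h : 0 < R.cz) : 0 < klE3U₀ R := by
  have hA := klE3A1_pos R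
  have hκ : (0 : ℝ) < Real.sqrt (2 * (7 + 1606732)) := Real.sqrt_pos.2 (by norm_num)
  unfold klE3U₀
  refine lt_min (by positivity) (by positivity)

/-- **`klEngU₀7 P R c := min (klEngU₀6 P R c) (klE3U₀ R)`** — the engine-flow coupling threshold with the two-leg door folded in. -/
def klEngU₀7 (P : SplitConsts) (R : RenConsts) (c : ℝ) : ℝ := min (klEngU₀6 P R c) (klE3U₀ R)

/-- `0 < klEngU₀7 P R c` whenever `0 < R.cz`. -/
theorem klEngU₀7_pos (P : SplitConsts) {R : RenConsts} (h : 0 < R.cz) (c : ℝ) : 0 < klEngU₀7 P R c :=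
  lt_min (klEngU₀6_pos P R c) (klE3U₀_pos h)

/-- `klEngU₀7 ≤ klEngU₀6`. -/
theorem klEngU₀7_le_klEngU₀6 (P : SplitConsts) (R : RenConsts) (c : ℝ) : klEngU₀7 P R c ≤ klEngU₀6 P R c := min_le_left _ _

/-- `klEngU₀7 ≤ klE3U₀`. -/
theorem klEngU₀7_le_klE3U₀ (P : SplitConsts) (R : RenConsts) (c : ℝ) : klEngU₀7 P R c ≤ klE3U₀ R := min_le_right _ _

/-- `klEngU₀7 ≤ klEngU₀4`. -/
theorem klEngU₀7_le_klEngU₀4 (P : SplitConsts) (R : RenConsts) (c : ℝ) : klEngU₀7 P R c ≤ klEngU₀4 P R c :=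
  (klEngU₀7_le_klEngU₀6 P R c).trans (klEngU₀6_le_klEngU₀4 P R c)

/-- `klEngU₀7 ≤ klEngU₀3`. -/
theorem klEngU₀7_le_klEngU₀3 (P : SplitConsts) (R : RenConsts) (c : ℝ) : klEngU₀7 P R c ≤ klEngU₀3 P R c :=
  (klEngU₀7_le_klEngU₀6 P R c).trans (klEngU₀6_le_klEngU₀3 P R c)

/-! ## §3 The four scale-0 numerals of the (M) closers under the door -/

/-- **The four scale-`0` numerals of the bare-frame two-leg closers at `a₁ := klE3A1 R` under `0 < U ≤ klE3U₀ R`** (`0 < R.cz`):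
the two smallnesses and the (E3d)/(E3e) fits. -/
theorem bareFrame_numerals_of_le_klE3U₀ {R : RenConsts} (hcz : 0 < R.cz) {U : ℝ} (hU : 0 < U) (hU7 : U ≤ klE3U₀ R) :
    16 * Real.exp 1 ^ 9 * Real.sqrt (2 * (7 + 1606732)) ^ 2 * klScaleZeroA0 * |U| ≤ 1 / 4 ∧
    16 * Real.exp 1 ^ 9 * Real.sqrt (2 * (7 + 1606732)) ^ 2 * klE3A1 R * |U| ≤ 1 / 2 ∧
    (2 : ℝ) ^ 10 * Real.exp 1 ^ 18 * Real.sqrt (2 * (7 + 1606732)) ^ 4 * klE3A1 R * U ^ 2 ≤ R.cz * |U| ∧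
    (2 : ℝ) ^ 11 * Real.exp 1 ^ 18 * Real.sqrt (2 * (7 + 1606732)) ^ 4 * klE3A1 R * U ^ 2 + 4 / 3 * R.Gfr 1 * U ^ 2 ≤
      R.cz * |U| * (cDtmin (-1.2) (-0.05) / 2) := by
  have hA := klE3A1_pos R
  have hA0 := klScaleZeroA0_pos
  have hA0le := klScaleZeroA0_le_klE3A1 R
  have hκ : (0 : ℝ) < Real.sqrt (2 * (7 + 1606732)) := Real.sqrt_pos.2 (by norm_num)
  have hD0 : 0 < (2 : ℝ) ^ 11 * Real.exp 1 ^ 18 * Real.sqrt (2 * (7 + 1606732)) ^ 4 * klE3A1 R + 4 / 3 * |R.Gfr 1| + 1 := by positivity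
  have habs : |U| = U := abs_of_pos hU
  -- the two branches of the door
  have h1 : U ≤ 1 / (64 * Real.exp 1 ^ 9 * Real.sqrt (2 * (7 + 1606732)) ^ 2 * klE3A1 R) := hU7.trans (min_le_left _ _)
  have h2 : U ≤ R.cz * (23 / 200) / ((2 : ℝ) ^ 11 * Real.exp 1 ^ 18 * Real.sqrt (2 * (7 + 1606732)) ^ 4 * klE3A1 R + 4 / 3 * |R.Gfr 1| + 1) :=
    hU7.trans (min_le_right _ _)
  have h1' : 64 * Real.exp 1 ^ 9 * Real.sqrt (2 * (7 + 1606732)) ^ 2 * klE3A1 R * U ≤ 1 := by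
    have hpos : 0 < 64 * Real.exp 1 ^ 9 * Real.sqrt (2 * (7 + 1606732)) ^ 2 * klE3A1 R := by positivity
    have := (le_div_iff₀ hpos).1 h1
    rw [mul_comm] at this; exact this
  have h2' : U * ((2 : ℝ) ^ 11 * Real.exp 1 ^ 18 * Real.sqrt (2 * (7 + 1606732)) ^ 4 * klE3A1 R + 4 / 3 * |R.Gfr 1| + 1) ≤ R.cz * (23 / 200) :=
    (le_div_iff₀ hD0).1 h2
  have hcD := cDtmin_wide_ge
  rw [habs]
  refine ⟨?_, ?_, ?_, ?_⟩
  · calc 16 * Real.exp 1 ^ 9 * Real.sqrt (2 * (7 + 1606732)) ^ 2 * klScaleZeroA0 * U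
        ≤ 16 * Real.exp 1 ^ 9 * Real.sqrt (2 * (7 + 1606732)) ^ 2 * klE3A1 R * U := by gcongr
      _ = (64 * Real.exp 1 ^ 9 * Real.sqrt (2 * (7 + 1606732)) ^ 2 * klE3A1 R * U) / 4 := by ring
      _ ≤ 1 / 4 := div_le_div_of_nonneg_right h1' (by norm_num)
  · calc 16 * Real.exp 1 ^ 9 * Real.sqrt (2 * (7 + 1606732)) ^ 2 * klE3A1 R * U
        = (64 * Real.exp 1 ^ 9 * Real.sqrt (2 * (7 + 1606732)) ^ 2 * klE3A1 R * U) / 4 := by ring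
      _ ≤ 1 / 4 := div_le_div_of_nonneg_right h1' (by norm_num)
      _ ≤ 1 / 2 := by norm_num
  · have hle : (2 : ℝ) ^ 11 * Real.exp 1 ^ 18 * Real.sqrt (2 * (7 + 1606732)) ^ 4 * klE3A1 R ≤
        (2 : ℝ) ^ 11 * Real.exp 1 ^ 18 * Real.sqrt (2 * (7 + 1606732)) ^ 4 * klE3A1 R + 4 / 3 * |R.Gfr 1| + 1 := by
      have := abs_nonneg (R.Gfr 1); linarith
    have hUD : U * ((2 : ℝ) ^ 11 * Real.exp 1 ^ 18 * Real.sqrt (2 * (7 + 1606732)) ^ 4 * klE3A1 R) ≤ R.cz * (23 / 200) :=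
      (mul_le_mul_of_nonneg_left hle hU.le).trans h2'
    calc (2 : ℝ) ^ 10 * Real.exp 1 ^ 18 * Real.sqrt (2 * (7 + 1606732)) ^ 4 * klE3A1 R * U ^ 2
        = (U * ((2 : ℝ) ^ 11 * Real.exp 1 ^ 18 * Real.sqrt (2 * (7 + 1606732)) ^ 4 * klE3A1 R)) * U / 2 := by ring
      _ ≤ R.cz * (23 / 200) * U / 2 := by gcongr
      _ ≤ R.cz * U := by nlinarith [mul_pos hcz hU]
  · have hle : (2 : ℝ) ^ 11 * Real.exp 1 ^ 18 * Real.sqrt (2 * (7 + 1606732)) ^ 4 * klE3A1 R + 4 / 3 * R.Gfr 1 ≤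
        (2 : ℝ) ^ 11 * Real.exp 1 ^ 18 * Real.sqrt (2 * (7 + 1606732)) ^ 4 * klE3A1 R + 4 / 3 * |R.Gfr 1| + 1 := by
      have := le_abs_self (R.Gfr 1); linarith
    have hUD : U * ((2 : ℝ) ^ 11 * Real.exp 1 ^ 18 * Real.sqrt (2 * (7 + 1606732)) ^ 4 * klE3A1 R + 4 / 3 * R.Gfr 1) ≤ R.cz * (23 / 200) :=
      (mul_le_mul_of_nonneg_left hle hU.le).trans h2'
    have hc2 : (23 : ℝ) / 200 ≤ cDtmin (-1.2) (-0.05) / 2 := by linarith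
    calc (2 : ℝ) ^ 11 * Real.exp 1 ^ 18 * Real.sqrt (2 * (7 + 1606732)) ^ 4 * klE3A1 R * U ^ 2 + 4 / 3 * R.Gfr 1 * U ^ 2
        = U * ((2 : ℝ) ^ 11 * Real.exp 1 ^ 18 * Real.sqrt (2 * (7 + 1606732)) ^ 4 * klE3A1 R + 4 / 3 * R.Gfr 1) * U := by ring
      _ ≤ R.cz * (23 / 200) * U := mul_le_mul_of_nonneg_right hUD hU.le
      _ ≤ R.cz * (cDtmin (-1.2) (-0.05) / 2) * U := by
          exact mul_le_mul_of_nonneg_right (mul_le_mul_of_nonneg_left hc2 hcz.le) hU.le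
      _ = R.cz * U * (cDtmin (-1.2) (-0.05) / 2) := by ring

/-! ## §4 (appended, T2-2 g12 condition (β) «size the door for ALL scales now») — the cumulative majorant placeholder and the all-scales door -/

/-- **`klE3Acum R := 2^40 · klE3A1 R`** — REGISTRATION PLACEHOLDER for a majorant of the CUMULATIVE second-order (E3d)/(E3e) coefficients
`Σ_{m ≤ n_β+1} C_m(R)` of the flow (`z_n − 1 = Σ_{m ≤ n} δz_m`, each `δz_m` second order with BGM's `4^{−θm}` gain, so the sum is finite): the (e)
lane proves `Σ_m C_m ≤ klE3Acum R` (slack `2^40` over the scale-`0` constant); the scale-`0` coefficient is `≤ klE3A1 R ≤ klE3Acum R`. -/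
def klE3Acum (R : RenConsts) : ℝ := (2 : ℝ) ^ 40 * klE3A1 R

/-- `klE3A1 R ≤ klE3Acum R`. -/
theorem klE3A1_le_klE3Acum (R : RenConsts) : klE3A1 R ≤ klE3Acum R := by
  unfold klE3Acum; have := klE3A1_pos R; nlinarith

/-- `0 < klE3Acum R`. -/
theorem klE3Acum_pos (R : RenConsts) : 0 < klE3Acum R := lt_of_lt_of_le (klE3A1_pos R) (klE3A1_le_klE3Acum R)

/-- **`klE3U₀all R`** — the ALL-SCALES two-leg coupling door: `klE3U₀` with `klE3A1 ↦ klE3Acum`: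
`min (1/(64e⁹κ₀²·klE3Acum R)) (R.cz·(23/200)/(2^{11}e¹⁸κ₀⁴·klE3Acum R + (4/3)|Gfr₁| + 1))`. -/
def klE3U₀all (R : RenConsts) : ℝ :=
  min (1 / (64 * Real.exp 1 ^ 9 * Real.sqrt (2 * (7 + 1606732)) ^ 2 * klE3Acum R))
    (R.cz * (23 / 200) / ((2 : ℝ) ^ 11 * Real.exp 1 ^ 18 * Real.sqrt (2 * (7 + 1606732)) ^ 4 * klE3Acum R + 4 / 3 * |R.Gfr 1| + 1))

/-- `0 < klE3U₀all R` whenever `0 < R.cz`. -/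
theorem klE3U₀all_pos {R : RenConsts} (h : 0 < R.cz) : 0 < klE3U₀all R := by
  have hA := klE3Acum_pos R
  have hκ : (0 : ℝ) < Real.sqrt (2 * (7 + 1606732)) := Real.sqrt_pos.2 (by norm_num)
  unfold klE3U₀all
  refine lt_min (by positivity) (by positivity)

/-- **The all-scales door is inside the scale-`0` door**: `klE3U₀all R ≤ klE3U₀ R` (the denominators only grew). -/
theorem klE3U₀all_le_klE3U₀ {R : RenConsts} (h : 0 < R.cz) : klE3U₀all R ≤ klE3U₀ R := by
  have hA := klE3A1_pos R
  have hAc := klE3A1_le_klE3Acum R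
  have hκ : (0 : ℝ) < Real.sqrt (2 * (7 + 1606732)) := Real.sqrt_pos.2 (by norm_num)
  have hG : 0 ≤ |R.Gfr 1| := abs_nonneg _
  unfold klE3U₀all klE3U₀
  refine min_le_min ?_ ?_
  · exact one_div_le_one_div_of_le (by positivity) (by gcongr)
  · exact div_le_div_of_nonneg_left (by positivity) (by positivity) (by gcongr)

/-- **`klEngU₀8 P R c := min (klEngU₀6 P R c) (klE3U₀all R)`** — the engine-flow coupling threshold with the ALL-SCALES two-leg door folded in (the
registrant's token: `klEngU₀6 ↦ klEngU₀8`; `klEngU₀7` is the scale-`0`-only sub-door). -/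
def klEngU₀8 (P : SplitConsts) (R : RenConsts) (c : ℝ) : ℝ := min (klEngU₀6 P R c) (klE3U₀all R)

/-- `0 < klEngU₀8 P R c` whenever `0 < R.cz` (under `R.WF2`: `hR.2.2`). -/
theorem klEngU₀8_pos (P : SplitConsts) {R : RenConsts} (h : 0 < R.cz) (c : ℝ) : 0 < klEngU₀8 P R c :=
  lt_min (klEngU₀6_pos P R c) (klE3U₀all_pos h)

/-- `0 < klEngU₀8 P R c` under `R.WF2`. -/
theorem klEngU₀8_pos_of_WF2 (P : SplitConsts) {R : RenConsts} (hR : R.WF2) (c : ℝ) : 0 < klEngU₀8 P R c :=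
  klEngU₀8_pos P hR.2.2 c

/-- `klEngU₀8 ≤ klEngU₀6`. -/
theorem klEngU₀8_le_klEngU₀6 (P : SplitConsts) (R : RenConsts) (c : ℝ) : klEngU₀8 P R c ≤ klEngU₀6 P R c := min_le_left _ _

/-- `klEngU₀8 ≤ klE3U₀all`. -/
theorem klEngU₀8_le_klE3U₀all (P : SplitConsts) (R : RenConsts) (c : ℝ) : klEngU₀8 P R c ≤ klE3U₀all R := min_le_right _ _

/-- `klEngU₀8 ≤ klE3U₀` (so the scale-`0` numerals `bareFrame_numerals_of_le_klE3U₀` apply under the all-scales threshold). -/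
theorem klEngU₀8_le_klE3U₀ (P : SplitConsts) {R : RenConsts} (h : 0 < R.cz) (c : ℝ) : klEngU₀8 P R c ≤ klE3U₀ R :=
  (klEngU₀8_le_klE3U₀all P R c).trans (klE3U₀all_le_klE3U₀ h)

/-- `klEngU₀8 ≤ klEngU₀7`. -/
theorem klEngU₀8_le_klEngU₀7 (P : SplitConsts) {R : RenConsts} (h : 0 < R.cz) (c : ℝ) : klEngU₀8 P R c ≤ klEngU₀7 P R c :=
  le_min (klEngU₀8_le_klEngU₀6 P R c) (klEngU₀8_le_klE3U₀ P h c)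

/-- `klEngU₀8 ≤ klEngU₀4`. -/
theorem klEngU₀8_le_klEngU₀4 (P : SplitConsts) (R : RenConsts) (c : ℝ) : klEngU₀8 P R c ≤ klEngU₀4 P R c :=
  (klEngU₀8_le_klEngU₀6 P R c).trans (klEngU₀6_le_klEngU₀4 P R c)

/-- `klEngU₀8 ≤ klEngU₀3`. -/
theorem klEngU₀8_le_klEngU₀3 (P : SplitConsts) (R : RenConsts) (c : ℝ) : klEngU₀8 P R c ≤ klEngU₀3 P R c :=
  (klEngU₀8_le_klEngU₀6 P R c).trans (klEngU₀6_le_klEngU₀3 P R c)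

/-- **The four scale-`0` numerals under the ALL-SCALES threshold** (`0 < R.cz`, `0 < U ≤ klEngU₀8 P R c`). -/
theorem bareFrame_numerals_of_le_klEngU₀8 (P : SplitConsts) {R : RenConsts} (hcz : 0 < R.cz) {c U : ℝ} (hU : 0 < U)
    (hU8 : U ≤ klEngU₀8 P R c) :
    16 * Real.exp 1 ^ 9 * Real.sqrt (2 * (7 + 1606732)) ^ 2 * klScaleZeroA0 * |U| ≤ 1 / 4 ∧
    16 * Real.exp 1 ^ 9 * Real.sqrt (2 * (7 + 1606732)) ^ 2 * klE3A1 R * |U| ≤ 1 / 2 ∧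
    (2 : ℝ) ^ 10 * Real.exp 1 ^ 18 * Real.sqrt (2 * (7 + 1606732)) ^ 4 * klE3A1 R * U ^ 2 ≤ R.cz * |U| ∧
    (2 : ℝ) ^ 11 * Real.exp 1 ^ 18 * Real.sqrt (2 * (7 + 1606732)) ^ 4 * klE3A1 R * U ^ 2 + 4 / 3 * R.Gfr 1 * U ^ 2 ≤
      R.cz * |U| * (cDtmin (-1.2) (-0.05) / 2) :=
  bareFrame_numerals_of_le_klE3U₀ hcz hU (hU8.trans (klEngU₀8_le_klE3U₀ P hcz c))

end Summit.HubbardSuperconductivity.HubbardSuperconductivity.Theorems.EngineV8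

end
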